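import Literature.ModelTheory.ExponentialFields.OMinimalSplitting
import HarnessLib

/-!
# Powers coinitial in the positive cone of a finitely generated definable closure (den Besten, Theorem 7.1.22, Claim 1)

Topic `Literature/ModelTheory/ExponentialFields`.  M. den Besten, *Wilkie's Theorem and the
Uniform Real Schanuel Conjecture* (MSc thesis, Utrecht 2016), proof of Theorem 7.1.22
(`valdim(K) ≤ dim(K)` for smooth o-minimal theories), p. 82:

> **Claim 1.** There exists `a ∈ K` with `a > 0` such that for all `b ∈ K` with `b > 0` we
> have `a^m < b` for some `m ∈ ℕ`.

proved there for `K = Dcl({c₁, …, cₙ})` of finite dimension by induction on `i` along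
`Kᵢ = Dcl({c₁, …, cᵢ})`, from `K₀ = Dcl(∅)` archimedean (`a₀ = 1/2`), condition `S₁`
(polynomial bounds, `IsPolynomiallyBounded`) and the exchange property of `Dcl`: if some positive
`β ∈ Kᵢ₊₁` lies below all powers of `aᵢ`, then `Kᵢ₊₁ = Dcl_{Kᵢ}(β⁻¹)`, every element of `Kᵢ₊₁`
is `f(β⁻¹)` with `f` `Kᵢ`-definable, `|f(x)| ≤ x^m` eventually, and `aᵢ₊₁ = β` works.

Here, for a polynomially bounded o-minimal expansion `M` of an ordered field
(`OMinimalSplitting.lean`):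

* `exists_pow_lt_definableClosure_insert` — **the inductive step**: if the powers of some
  `a ∈ dcl(A)`, `0 < a < 1`, are coinitial in the positive elements of `dcl(A)`, then the same
  holds for `dcl(A ∪ {c})` for every `c ∈ M`;
* `exists_pow_lt_definableClosure_union_finset` — hence for `dcl(A ∪ F)`, `F` finite;
* `exists_pow_lt_definableClosure_of_forall_abs_le` — **the base**: if `dcl(A)` is archimedean
  (every element bounded by a natural number) then `a = 1/2` works; and the printed Claim 1,
  `exists_pow_lt_definableClosure_finset` (`dcl(F)`, `F` finite, over an archimedean `dcl(∅)`).

The one deviation from the printed proof, as in `OMinimalSplitting.lean`: the threshold beyond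
which `|f(x)| ≤ x^m` holds is found in `dcl(Kᵢ) = Kᵢ` because the (non-empty, `Kᵢ`-definable) set
of thresholds meets `dcl(Kᵢ)` (`exists_mem_definableClosure_of_nonempty_of_orderedField`), rather
than by transfer along `Kᵢ ≼ Kᵢ₊₁`.  Nothing here is a named fact.

## References

* [DenBesten2016] M. den Besten, *Wilkie's Theorem and the Uniform Real Schanuel Conjecture*,
  MSc thesis, Utrecht 2016: Theorem 7.1.22, Claim 1 (p. 82); Remark 7.1.5; Lemma 7.1.6 (iv).
* [WilkieJAMS1996] A. J. Wilkie, J. Amer. Math. Soc. 9 (1996) 1051–1094, §10.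
-/

open Set FirstOrder FirstOrder.Language

namespace Literature.ModelTheory.ExponentialFields

section OrderedField

variable {L : Language.{0, 0}} {M : Type*} [L.Structure M] [Field M] [LinearOrder M]
  [IsStrictOrderedRing M] (φ : Language.orderedRing →ᴸ L) [φ.IsExpansionOn M]

include φ

open OrderedFieldExpansion

/-- **den Besten 2016, Theorem 7.1.22, Claim 1 — the inductive step.**  Let `M` be a polynomially
bounded o-minimal expansion of an ordered field and `A ⊆ M`.  If there is `a ∈ dcl(A)`,
`0 < a < 1`, whose powers are coinitial in the positive elements of `dcl(A)`, then for every
`c ∈ M` there is such an element for `dcl(A ∪ {c})`.  (If some positive `β ∈ dcl(A ∪ {c})` lies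
below all `a^m` then `β ∉ dcl(A)`, so `dcl(A ∪ {c}) = dcl(A ∪ {β⁻¹})` by exchange, each of its
elements is `f(β⁻¹)` for an `A`-definable `f` with `|f(x)| ≤ x^N` beyond a threshold in
`dcl(A)`, and `β` works.) [cite: DenBesten2016, Theorem 7.1.22, Claim 1] -/
theorem exists_pow_lt_definableClosure_insert (hO : L.IsOMinimal M)
    (hpb : IsPolynomiallyBounded L M) {A : Set M}
    (hA : ∃ a ∈ definableClosure L A, 0 < a ∧ a < 1 ∧
      ∀ b ∈ definableClosure L A, 0 < b → ∃ m : ℕ, a ^ m < b)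
    (c : M) :
    ∃ a ∈ definableClosure L (insert c A), 0 < a ∧ a < 1 ∧
      ∀ b ∈ definableClosure L (insert c A), 0 < b → ∃ m : ℕ, a ^ m < b := by
  classical
  obtain ⟨a, haA, ha0, ha1, hcoi⟩ := hA
  have hAc : definableClosure L A ⊆ definableClosure L (insert c A) :=
    definableClosure_mono (subset_insert c A)
  by_cases hgood : ∀ b ∈ definableClosure L (insert c A), 0 < b → ∃ m : ℕ, a ^ m < b
  · exact ⟨a, hAc haA, ha0, ha1, hgood⟩
  push Not at hgood
  obtain ⟨β, hβ, hβ0, hβle⟩ := hgood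
  -- `β < a ^ m` for all `m`
  have hβlt : ∀ m : ℕ, β < a ^ m := fun m =>
    (hβle (m + 1)).trans_lt (pow_lt_pow_right_of_lt_one₀ ha0 ha1 (Nat.lt_succ_self m))
  have hβ1 : β < 1 := by simpa using hβlt 0
  -- `β` is below every positive element of `dcl(A)`, in particular `β ∉ dcl(A)`
  have hβsmall : ∀ b ∈ definableClosure L A, 0 < b → β < b := fun b hb hb0 => by
    obtain ⟨m, hm⟩ := hcoi b hb hb0
    exact (hβlt m).trans hm
  have hβA : β ∉ definableClosure L A := fun h => lt_irrefl β (hβsmall β h hβ0)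
  -- exchange: `dcl(A ∪ {c}) ⊆ dcl(A ∪ {β⁻¹})`
  have hcβ : c ∈ definableClosure L (insert β A) :=
    exchange_definableClosure hO (definable_lt_empty_of_expansion φ) hβ hβA
  have hββ : β ∈ definableClosure L (insert β⁻¹ A) := by
    have h := inv_mem_definableClosure φ (A := insert β⁻¹ A)
      (subset_definableClosure _ (mem_insert β⁻¹ A))
    rwa [inv_inv] at h
  have hsub₁ : definableClosure L (insert β A) ⊆ definableClosure L (insert β⁻¹ A) :=
    definableClosure_subset_of_subset (L := L) (insert_subset hββ
      ((subset_insert _ A).trans (subset_definableClosure _)))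
  have hsub : definableClosure L (insert c A) ⊆ definableClosure L (insert β⁻¹ A) :=
    definableClosure_subset_of_subset (L := L) (insert_subset (hsub₁ hcβ)
      ((subset_insert _ A).trans (subset_definableClosure _)))
  refine ⟨β, hβ, hβ0, hβ1, fun b hb hb0 => ?_⟩
  -- `b⁻¹ = f(β⁻¹)` for an `A`-definable `f`, polynomially bounded beyond a threshold in `dcl(A)`
  obtain ⟨f, hf, hfβ⟩ :=
    exists_fun_of_mem_definableClosure_insert (hsub (inv_mem_definableClosure φ hb))
  obtain ⟨N, t₀, ht₀⟩ := hpb f (hf.mono (subset_univ A))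
  have hltA : A.Definable L {v : Fin 2 → M | v 0 < v 1} := definable_lt φ A
  have hTdef : A.Definable₁ L {t : M | ∀ x, t < x → |f x| ≤ x ^ N} := by
    show A.Definable L {v : Fin 1 → M | ∀ x, v 0 < x → |f x| ≤ x ^ N}
    apply definable_setOf_forall_params
    apply definable_setOf_imp_params
    · exact definable_setOf_lt_params hltA (definableFun_proj_params _)
        (definableFun_proj_params _)
    · have h1 : A.Definable L {w : Fin 1 ⊕ Unit → M |
          -(w (Sum.inr ()) ^ N) ≤ f (w (Sum.inr ())) ∧
            f (w (Sum.inr ())) ≤ w (Sum.inr ()) ^ N} := by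
        apply definable_setOf_and_params
        · exact definable_setOf_le_params hltA
            (definableFun_neg φ (definableFun_pow φ (definableFun_proj_params _) N))
            (definableFun_apply_params hf (definableFun_proj_params _))
        · exact definable_setOf_le_params hltA
            (definableFun_apply_params hf (definableFun_proj_params _))
            (definableFun_pow φ (definableFun_proj_params _) N)
      refine (congrArg _ ?_).mpr h1
      ext w
      simp only [mem_setOf_eq]
      exact abs_le
  obtain ⟨t, htA, ht⟩ :=
    exists_mem_definableClosure_of_nonempty_of_orderedField φ hO hTdef ⟨t₀, ht₀⟩
  -- `β⁻¹` is beyond the threshold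
  have hβt : t < β⁻¹ := by
    rcases le_or_gt t 0 with ht0 | ht0
    · exact ht0.trans_lt (inv_pos.2 hβ0)
    · have h := hβsmall t⁻¹ (inv_mem_definableClosure φ htA) (inv_pos.2 ht0)
      exact (lt_inv_comm₀ hβ0 ht0).1 h
  have hbound : |f β⁻¹| ≤ β⁻¹ ^ N := ht β⁻¹ hβt
  rw [hfβ, abs_of_pos (inv_pos.2 hb0), inv_pow] at hbound
  have hle : β ^ N ≤ b := (inv_le_inv₀ hb0 (pow_pos hβ0 N)).1 hbound
  exact ⟨N + 1, (pow_lt_pow_right_of_lt_one₀ hβ0 hβ1 (Nat.lt_succ_self N)).trans_le hle⟩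

/-- **Claim 1 for finitely many generators**: the conclusion of
`exists_pow_lt_definableClosure_insert` for `dcl(A ∪ F)`, `F` a finite set, by induction on `F`.
[cite: DenBesten2016, Theorem 7.1.22, Claim 1] -/
theorem exists_pow_lt_definableClosure_union_finset (hO : L.IsOMinimal M)
    (hpb : IsPolynomiallyBounded L M) {A : Set M}
    (hA : ∃ a ∈ definableClosure L A, 0 < a ∧ a < 1 ∧
      ∀ b ∈ definableClosure L A, 0 < b → ∃ m : ℕ, a ^ m < b)
    (F : Finset M) :
    ∃ a ∈ definableClosure L (A ∪ ↑F), 0 < a ∧ a < 1 ∧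
      ∀ b ∈ definableClosure L (A ∪ ↑F), 0 < b → ∃ m : ℕ, a ^ m < b := by
  classical
  induction F using Finset.induction_on with
  | empty => simpa using hA
  | insert c F _ ih =>
    have h := exists_pow_lt_definableClosure_insert φ hO hpb ih c
    have heq : insert c (A ∪ ↑F) = A ∪ ↑(insert c F) := by
      rw [Finset.coe_insert, union_insert]
    rwa [heq] at h

/-- **The base of Claim 1**: if `dcl(A)` is archimedean (every element is bounded in absolute
value by a natural number; e.g. `Dcl(∅)`, den Besten 2016, Remark 7.1.5), then the powers of
`1/2 ∈ dcl(A)` are coinitial in the positive elements of `dcl(A)`. [cite: DenBesten2016, Theorem 7.1.22, Claim 1] -/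
theorem exists_pow_lt_definableClosure_of_forall_abs_le {A : Set M}
    (harch : ∀ x ∈ definableClosure L A, ∃ n : ℕ, |x| ≤ n) :
    ∃ a ∈ definableClosure L A, 0 < a ∧ a < 1 ∧
      ∀ b ∈ definableClosure L A, 0 < b → ∃ m : ℕ, a ^ m < b := by
  have h0 : (0 : M) ∈ definableClosure L A :=
    definableClosure_mono (empty_subset A) (zero_mem_definableClosure φ)
  have h1 : (1 : M) ∈ definableClosure L A := by
    have h := add_one_mem_definableClosure φ (0 : M)
    rw [zero_add] at h
    exact definableClosure_subset_of_subset (L := L) (singleton_subset_iff.2 h0) h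
  have hhalf : (1 / 2 : M) ∈ definableClosure L A := by
    have h := midpoint_mem_definableClosure φ (0 : M) 1
    rw [zero_add] at h
    exact definableClosure_subset_of_subset (L := L) (insert_subset h0
      (singleton_subset_iff.2 h1)) h
  refine ⟨1 / 2, hhalf, by norm_num, by norm_num, fun b hb hb0 => ?_⟩
  obtain ⟨n, hn⟩ := harch b⁻¹ (inv_mem_definableClosure φ hb)
  rw [abs_of_pos (inv_pos.2 hb0)] at hn
  refine ⟨n, ?_⟩
  have h2n : (n : M) < 2 ^ n := by exact_mod_cast Nat.lt_two_pow_self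
  have hbinv : b⁻¹ < 2 ^ n := hn.trans_lt h2n
  rw [one_div, inv_pow]
  exact (inv_lt_comm₀ (pow_pos two_pos n) hb0).2 hbinv

/-- **den Besten 2016, Theorem 7.1.22, Claim 1** as printed: in a polynomially bounded
o-minimal expansion of an ordered field in which `dcl(∅)` is archimedean, for every finite `F`
there is `a ∈ dcl(F)`, `0 < a < 1`, such that every positive `b ∈ dcl(F)` exceeds some power
`a^m`. [cite: DenBesten2016, Theorem 7.1.22, Claim 1] -/
theorem exists_pow_lt_definableClosure_finset (hO : L.IsOMinimal M)
    (hpb : IsPolynomiallyBounded L M)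
    (harch : ∀ x ∈ definableClosure L (∅ : Set M), ∃ n : ℕ, |x| ≤ n) (F : Finset M) :
    ∃ a ∈ definableClosure L (↑F : Set M), 0 < a ∧ a < 1 ∧
      ∀ b ∈ definableClosure L (↑F : Set M), 0 < b → ∃ m : ℕ, a ^ m < b := by
  have h := exists_pow_lt_definableClosure_union_finset φ hO hpb
    (exists_pow_lt_definableClosure_of_forall_abs_le φ harch) F
  rwa [empty_union] at h

end OrderedField

end Literature.ModelTheory.ExponentialFields
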